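import Literature.NumberTheory.EllipticCurves.HeegnerEnvelopeReverseProofs
import HarnessLib

/-!
# Scaling EQUALITY for characteristic ideals of quotients over torsion-free `𝔖`:
# `char(𝔖/(a·ℳ)) = (a)·char(𝔖/ℳ)`, and the `s_env` letter `(p^e)·I(ℋ_F) ⊆ I(Λκ_C)` from `(p^e)·ℋ_F ⊆ Λκ_C`
# (module theory over `Λ = ℤ_p⟦T⟧`; proofs file)

Topic `NumberTheory/EllipticCurves`. THEOREMS ONLY; sequel of `HeegnerCharIdealScalingTransferProofs` (the
inequality `char(𝔖/N) ⊆ (a)·char(𝔖/ℳ)` for `N ⊆ aℳ`) — here the EQUALITY when `𝔖` is torsion-free (then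
multiplication by `a` maps `ℳ/Λz` ISOMORPHICALLY onto `aℳ/Λ(az)`), and its consumer for the stub
`stub_envelopeTied` of crux stmt-BirchSwinnertonDyer-26359 (`PrintX9.HowardContainmentLightFramePinnedOfPrint`):
the letter of `Stmt.envelopeTied` asks `span{p^e} * heegnerCharIdeal D F ≤ stabilizedHeegnerCharIdeal D C`,
which is `char(𝔖/(p^e•ℋ_F)) ≤ char(𝔖/Λκ_C)` (`charIdeal_quotient_le_of_le`) once
`char(𝔖/(p^e•ℋ_F)) = (p^e)·char(𝔖/ℋ_F)`. Written by the cell `bsd-print-x9` seat `bsd-line-x9-p2`.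

WHAT. `Module.charIdeal_quotient_smul_eq_span_mul` (torsion-free `𝔖`, `ℳ ∋ z ≠ 0` with `𝔖/Λz` torsion,
`a ≠ 0`, `𝔖/aℳ` torsion); `span_pow_mul_heegnerCharIdeal_le_stabilizedHeegnerCharIdeal_of_pow_smul_le`
(`𝔖` f.g. torsion-free of `finrank 1`, `(p^e)•ℋ_F ≤ Λκ_C`, `𝔖/ℋ_F` torsion ⟹ `(p^e)·I(ℋ_F) ≤ I(Λκ_C)`).
HONEST FRAMING: pure algebra plus one specialisation; BSD is not proved by any of this.

References: [NeukirchSchmidtWingberg2008] Ch. V §3; [Washington1997] §13.2; [CastellaGrossiLeeSkinner2022]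
Rem. 4.1.4, §3.3 (torsion-freeness of `H¹_{𝓕_Λ}(K, 𝐓)`).
-/

set_option autoImplicit false

noncomputable section

open scoped Classical Pointwise

namespace Literature.NumberTheory.EllipticCurves

namespace Module

variable {p : ℕ} [Fact p.Prime]

/-- **`char(𝔖/(a·ℳ)) = (a)·char(𝔖/ℳ)`** for `𝔖` finitely generated and torsion-free over `Λ`, `a ≠ 0`,
`ℳ ∋ z ≠ 0` with `𝔖/Λz` torsion and `𝔖/aℳ` torsion: as in `charIdeal_quotient_le_span_mul_of_le_smul`, with
multiplication by `a` now an ISOMORPHISM `ℳ/Λz ≅ aℳ/Λ(az)`. [cite: NeukirchSchmidtWingberg2008, Ch. V §3, Remark 2 after (5.3.9) (multiplicativity of characteristic ideals)]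
[cite: Washington1997, §13.2 (char(Λ/(f)) = (f))] -/
theorem charIdeal_quotient_smul_eq_span_mul {S : Type*} [AddCommGroup S]
    [_root_.Module (IwasawaAlgebra p) S] [Module.Finite (IwasawaAlgebra p) S]
    [NoZeroSMulDivisors (IwasawaAlgebra p) S]
    {M : Submodule (IwasawaAlgebra p) S} {a : IwasawaAlgebra p} (ha : a ≠ 0)
    (htor : Module.IsTorsion (IwasawaAlgebra p) (S ⧸ (a • M))) {z : S} (hzM : z ∈ M) (hz0 : z ≠ 0)
    (htorL : Module.IsTorsion (IwasawaAlgebra p) (S ⧸ Submodule.span (IwasawaAlgebra p) {z})) :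
    charIdeal (IwasawaAlgebra p) (S ⧸ (a • M)) =
      Ideal.span {a} * charIdeal (IwasawaAlgebra p) (S ⧸ M) := by
  have hz : ∀ b : IwasawaAlgebra p, b • z = 0 → b = 0 := fun b hb ↦
    (smul_eq_zero.mp hb).resolve_right hz0
  haveI : IsNoetherian (IwasawaAlgebra p) S := isNoetherian_of_isNoetherianRing_of_finite _ _
  set L := Submodule.span (IwasawaAlgebra p) {z} with hL
  set La := Submodule.span (IwasawaAlgebra p) {a • z} with hLa
  set Ma : Submodule (IwasawaAlgebra p) S := a • M with hMa
  -- the four inclusions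
  have hMaM : Ma ≤ M := Submodule.smul_le_self_of_tower a M
  have hLM : L ≤ M := by rw [hL, Submodule.span_singleton_le_iff_mem]; exact hzM
  have hLaMa : La ≤ Ma := by
    rw [hLa, Submodule.span_singleton_le_iff_mem]
    exact Submodule.smul_mem_pointwise_smul _ _ _ hzM
  have hLaL : La ≤ L := by
    rw [hLa, Submodule.span_singleton_le_iff_mem]
    exact Submodule.smul_mem _ a (Submodule.mem_span_singleton_self z)
  -- torsion of the quotients involved
  have htorMa : Module.IsTorsion (IwasawaAlgebra p) (S ⧸ Ma) := htor
  have htorLa : Module.IsTorsion (IwasawaAlgebra p) (S ⧸ La) := fun x ↦ by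
    obtain ⟨s, rfl⟩ := Submodule.Quotient.mk_surjective _ x
    obtain ⟨⟨b, hb⟩, hbs⟩ := @htorL (Submodule.Quotient.mk s)
    rw [Submonoid.mk_smul, ← Submodule.Quotient.mk_smul, Submodule.Quotient.mk_eq_zero, hL,
      Submodule.mem_span_singleton] at hbs
    obtain ⟨c, hc⟩ := hbs
    refine ⟨⟨a * b, mul_mem (mem_nonZeroDivisors_of_ne_zero ha) hb⟩, ?_⟩
    rw [Submonoid.mk_smul, ← Submodule.Quotient.mk_smul, Submodule.Quotient.mk_eq_zero, hLa,
      Submodule.mem_span_singleton, mul_smul, ← hc, smul_comm]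
    exact ⟨c, rfl⟩
  -- (i) `char(S/La) = char(K₁)·char(S/Ma)`, `K₁ = ker(S/La ↠ S/Ma)`
  set g₁ : (S ⧸ La) →ₗ[IwasawaAlgebra p] (S ⧸ Ma) := Submodule.factor hLaMa with hg₁
  set K₁ := LinearMap.ker g₁ with hK₁
  have e₁ := charIdeal_eq_mul_of_exact (R := IwasawaAlgebra p) htorLa K₁.subtype g₁
    (Submodule.injective_subtype _) (Submodule.factor_surjective hLaMa) (LinearMap.exact_subtype_ker_map _)
  -- (ii) `char(S/L) = char(K₂)·char(S/M)`, `K₂ = ker(S/L ↠ S/M)`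
  set g₂ : (S ⧸ L) →ₗ[IwasawaAlgebra p] (S ⧸ M) := Submodule.factor hLM with hg₂
  set K₂ := LinearMap.ker g₂ with hK₂
  have e₂ := charIdeal_eq_mul_of_exact (R := IwasawaAlgebra p) htorL K₂.subtype g₂
    (Submodule.injective_subtype _) (Submodule.factor_surjective hLM) (LinearMap.exact_subtype_ker_map _)
  -- (iii) the cyclic case `char(S/La) = (a)·char(S/L)`
  have e₃ := charIdeal_quotient_span_smul_eq (S := S) hz htorL ha
  -- (iv) multiplication by `a`: `K₂ ↠ K₁`
  let ψ₀ : (S ⧸ L) →ₗ[IwasawaAlgebra p] (S ⧸ La) :=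
    Submodule.mapQ L La (a • LinearMap.id) (by
      intro x hx
      rw [hL, Submodule.mem_span_singleton] at hx
      obtain ⟨c, rfl⟩ := hx
      show a • (c • z) ∈ La
      rw [smul_comm, hLa]
      exact Submodule.smul_mem _ c (Submodule.mem_span_singleton_self _))
  have hψ₀ : ∀ s : S, ψ₀ (Submodule.Quotient.mk s) = Submodule.Quotient.mk (a • s) := fun s ↦
    Submodule.mapQ_apply _ _ _ s
  have hmemK₁ : ∀ s : S, (Submodule.Quotient.mk s : S ⧸ La) ∈ K₁ ↔ s ∈ Ma := fun s ↦ by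
    rw [hK₁, LinearMap.mem_ker, show g₁ (Submodule.Quotient.mk s) = (Submodule.Quotient.mk s : S ⧸ Ma)
      from rfl, Submodule.Quotient.mk_eq_zero]
  have hmemK₂ : ∀ s : S, (Submodule.Quotient.mk s : S ⧸ L) ∈ K₂ ↔ s ∈ M := fun s ↦ by
    rw [hK₂, LinearMap.mem_ker, show g₂ (Submodule.Quotient.mk s) = (Submodule.Quotient.mk s : S ⧸ M)
      from rfl, Submodule.Quotient.mk_eq_zero]
  have hmaps : ∀ x : K₂, ψ₀ (x : S ⧸ L) ∈ K₁ := by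
    rintro ⟨x, hx⟩
    obtain ⟨s, rfl⟩ := Submodule.Quotient.mk_surjective _ x
    rw [hψ₀, hmemK₁]
    exact Submodule.smul_mem_pointwise_smul _ _ _ ((hmemK₂ s).mp hx)
  let ψ : K₂ →ₗ[IwasawaAlgebra p] K₁ := LinearMap.codRestrict K₁ (ψ₀.comp K₂.subtype) hmaps
  have hψsurj : Function.Surjective ψ := by
    rintro ⟨y, hy⟩
    obtain ⟨s, rfl⟩ := Submodule.Quotient.mk_surjective _ y
    obtain ⟨t, ht, rfl⟩ := (Submodule.mem_smul_pointwise_iff_exists _ _ _).mp ((hmemK₁ _).mp hy)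
    refine ⟨⟨Submodule.Quotient.mk t, (hmemK₂ t).mpr ht⟩, ?_⟩
    apply Subtype.ext
    show ψ₀ (Submodule.Quotient.mk t) = Submodule.Quotient.mk (a • t)
    exact hψ₀ t
  have htorK₂ : Module.IsTorsion (IwasawaAlgebra p) K₂ := fun x ↦ by
    obtain ⟨b, hb⟩ := @htorL (x : S ⧸ L)
    exact ⟨b, Subtype.ext (by rw [Submonoid.smul_def, Submodule.coe_smul, ZeroMemClass.coe_zero]; exact hb)⟩
  haveI : Module.Finite (IwasawaAlgebra p) K₂ := Module.IsNoetherian.finite _ _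
  have hψinj : Function.Injective ψ := by
    rintro ⟨u, hu⟩ ⟨v, hv⟩ huv
    apply Subtype.ext
    obtain ⟨su, rfl⟩ := Submodule.Quotient.mk_surjective _ u
    obtain ⟨sv, rfl⟩ := Submodule.Quotient.mk_surjective _ v
    have h1 : ψ₀ (Submodule.Quotient.mk su) = ψ₀ (Submodule.Quotient.mk sv) := congrArg Subtype.val huv
    rw [hψ₀, hψ₀, Submodule.Quotient.eq, hLa, Submodule.mem_span_singleton] at h1
    obtain ⟨c, hc⟩ := h1
    show (Submodule.Quotient.mk su : S ⧸ L) = Submodule.Quotient.mk sv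
    rw [Submodule.Quotient.eq, hL, Submodule.mem_span_singleton]
    refine ⟨c, ?_⟩
    have h2 : a • (c • z) = a • (su - sv) := by rw [smul_sub, ← hc, smul_comm]
    exact smul_right_injective S ha h2
  clear_value ψ
  set K₃ := LinearMap.ker ψ with hK₃
  have hexact : Function.Exact K₃.subtype ψ := by
    rw [hK₃]; exact LinearMap.exact_subtype_ker_map ψ
  have e₄ : charIdeal (IwasawaAlgebra p) K₂ =
      charIdeal (IwasawaAlgebra p) K₃ * charIdeal (IwasawaAlgebra p) K₁ :=
    charIdeal_eq_mul_of_exact (R := IwasawaAlgebra p) (M' := K₃) (M := K₂) (M'' := K₁) htorK₂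
      K₃.subtype ψ (Submodule.injective_subtype _) hψsurj hexact
  -- `ψ` is injective (`S` torsion-free), so `char(K₃) = 1`
  have hK₃ : charIdeal (IwasawaAlgebra p) K₃ = 1 := by
    haveI : Subsingleton K₃ := by
      refine ⟨fun x y ↦ Subtype.ext (hψinj ?_)⟩
      have hx : ψ x.1 = 0 := x.2
      have hy : ψ y.1 = 0 := y.2
      rw [hx, hy]
    unfold charIdeal
    rw [finprod_mem_eq_one_of_forall_eq_one]
    intro 𝔭 _
    rw [lengthAt_eq_zero_of_subsingleton, ENat.toNat_zero, pow_zero]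
  -- cancel `char(K₁)`
  have key : charIdeal (IwasawaAlgebra p) K₁ * charIdeal (IwasawaAlgebra p) (S ⧸ Ma) =
      charIdeal (IwasawaAlgebra p) K₁ * (Ideal.span {a} * charIdeal (IwasawaAlgebra p) (S ⧸ M)) := by
    rw [← e₁, e₃, e₂, e₄, hK₃, one_mul]; ring
  exact eq_of_charIdeal_mul_eq (p := p) K₁ key


end Module

/-! ## The `s_env` letter -/

section Heegner

open WeierstrassCurve CastellaGrossiLeeSkinner2022

universe u

variable {K : Type u} [Field K] [NumberField K] {N : ℕ} [NeZero N] {W : WeierstrassCurve ℚ}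
  [W.IsGloballyMinimal] {p : ℕ} [Fact p.Prime] {κ : ZpExtension K p} {γ : Field.absoluteGaloisGroup K}
  {jbar : AlgebraicClosure K →+* ℂ}

/-- **`(p^e)•ℋ_F ⊆ Λκ_C ⟹ (p^e)·I(ℋ_F) ⊆ I(Λκ_C)`** for `𝔖 = D.S` finitely generated, torsion-free, of
`finrank 1` and `𝔖/ℋ_F` torsion — the inequality clause of `Stmt.envelopeTied` from the submodule envelope.
[cite: CastellaGrossiLeeSkinner2022, Rem. 4.1.4 and §3.3] [cite: PerrinRiou1987BSMF, §1 p. 405] -/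
theorem span_pow_mul_heegnerCharIdeal_le_stabilizedHeegnerCharIdeal_of_pow_smul_le
    (D : (W.baseChange K).LambdaAdicSelmerData κ γ) [Module.Finite (IwasawaAlgebra p) D.S]
    [NoZeroSMulDivisors (IwasawaAlgebra p) D.S] (hS1 : Module.finrank (IwasawaAlgebra p) D.S = 1)
    (F : HeegnerFamily N W K κ jbar) (C : StabilizedHeegnerData N W K κ jbar) (e : ℕ)
    (hle : ((p : IwasawaAlgebra p) ^ e) • heegnerModule D F ≤ stabilizedHeegnerModule D C)
    (htor : Module.IsTorsion (IwasawaAlgebra p) (D.S ⧸ heegnerModule D F)) :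
    Ideal.span {(p : IwasawaAlgebra p) ^ e} * heegnerCharIdeal D F ≤ stabilizedHeegnerCharIdeal D C := by
  have hp0 : (p : IwasawaAlgebra p) ≠ 0 := by
    rw [← map_natCast (PowerSeries.C (R := ℤ_[p])) p]
    exact (map_ne_zero_iff _ PowerSeries.C_injective).mpr (Nat.cast_ne_zero.mpr (Fact.out : p.Prime).ne_zero)
  have ha : (p : IwasawaAlgebra p) ^ e ≠ 0 := pow_ne_zero _ hp0
  -- a non-zero `z ∈ ℋ_F` with `𝔖/Λz` torsion
  obtain ⟨s₀, hs₀⟩ := Module.exists_torsionFree_of_finrank_eq_one (p := p) hS1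
  obtain ⟨⟨b, hb⟩, hbs⟩ := @htor (Submodule.Quotient.mk s₀)
  rw [Submonoid.mk_smul, ← Submodule.Quotient.mk_smul, Submodule.Quotient.mk_eq_zero] at hbs
  have hb0 : b ≠ 0 := nonZeroDivisors.ne_zero hb
  have hs00 : s₀ ≠ 0 := fun h ↦ one_ne_zero (hs₀ 1 (by rw [h, smul_zero]))
  have hz0 : b • s₀ ≠ 0 := smul_ne_zero hb0 hs00
  have hz : ∀ c : IwasawaAlgebra p, c • (b • s₀) = 0 → c = 0 := fun c hc ↦
    (smul_eq_zero.mp hc).resolve_right hz0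
  have htorL := Module.isTorsion_quotient_span_singleton_of_torsionFree_of_finrank_eq_one hS1 hz
  have hne : heegnerModule D F ≠ ⊥ := fun h ↦ hz0 (by rw [h] at hbs; exact (Submodule.mem_bot _).mp hbs)
  have htorA : Module.IsTorsion (IwasawaAlgebra p) (D.S ⧸ ((p : IwasawaAlgebra p) ^ e) • heegnerModule D F) :=
    Module.isTorsion_quotient_of_smul_le hS1 hne ha le_rfl
  rw [heegnerCharIdeal, ← Module.charIdeal_quotient_smul_eq_span_mul ha htorA hbs hz0 htorL,
    stabilizedHeegnerCharIdeal]
  exact Module.charIdeal_quotient_le_of_le hle htorA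

end Heegner

end Literature.NumberTheory.EllipticCurves

end
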